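import Summits.QuantumFields.GaugeBoot.WilsonLineObservables
import Literature.MathematicalPhysics.QuantumLattice.SU2Haar
import Literature.MathematicalPhysics.QuantumLattice.NarrowWellPlaquetteAction
import HarnessLib

/-!
# `SU(2)`: the multi-trace Wilson loop algebra is the span of single Wilson loops (gauge-boot, L1 supplement)

HONEST FRAMING (cell `pub-gaugeboot`, page 1 of every file): the venture produces certified bounds
on lattice expectations at stated coupling, gauge group, dimension and torus size; NOT a mass gap,
NOT a continuum limit, NOT a string tension; NOT Yang–Mills-summit-bearing (barriers
`FixedCouplingUltralocality`, `PerturbativeInvisibility`). Structural; it certifies no number.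

## Content

The finite-`N` lattice bootstrap on gauge-invariant data (`GaugeInvariantBootstrap`) has MULTI-trace
Wilson loops among its unknowns (products of traces; Kazakov–Zheng 2024). For `SU(2)` every
practical bootstrap works with SINGLE traces only, by the trace identity
`tr g · tr h = tr(gh) + tr(gh⁻¹)` (`g, h ∈ SU(2)`). This file proves the identity and its
consequence for the observables of the torus:

* ★ `su2_trace_mul_trace` (`tr g tr h = tr(gh) + tr(gh⁻¹)`; Cayley–Hamilton `B + adj B = tr B · 1`,
  the Fricke identity of the tree's `trace_mul_add_trace_mul_adjugate` inlined to keep the import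
  closure light; traces are real: tree `NarrowWell.trace_im_eq_zero`);
* `loopIm_su2` — `Im tr hol = 0`; ★★ `loopRe_mul_loopRe_su2` — for closed words `u, v` at `x`:
  `(Re tr hol u)(Re tr hol v) = Re tr hol(u·v) + Re tr hol(u·v̄)`;
* `loopRe_conj_path` / `loopIm_conj_path` — moving the base point along a lattice path
  (`tr` is conjugation invariant; any gauge group) and `exists_word_endpoint` (the torus is
  connected by lattice words), so every Wilson loop is a Wilson loop based at `x`;
* ★★★ `adjoin_loops_eq_singleTraceSpan_su2` — THE UNITAL ALGEBRA GENERATED BY ALL WILSON LOOP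
  OBSERVABLES (`Re`/`Im tr hol_y(w)`, all base points, all closed words: the multi-trace loop algebra)
  EQUALS, as a linear space, the SPAN of `1` and the single loops `Re tr hol_x(w)` at one base point;
  ★★★ `eqOn_adjoin_loops_of_eqOn_single_su2` — hence two linear functionals agreeing on `1` and on
  the single Wilson loops at `x` agree on every multi-trace Wilson loop observable: for `SU(2)` the
  single-trace data determine the multi-trace data (Kazakov–Zheng's `SU(2)` reduction).

What this is NOT: the first fundamental theorem (gauge-invariant POLYNOMIALS = loop algebra) is not
claimed; nothing for `N ≥ 3` (there the double traces are genuinely new unknowns); no rates.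

References: V. Kazakov, Z. Zheng, arXiv:2203.11360 §5 and arXiv:2404.16925 §4 (`SU(2)` reduction);
P. Anderson, M. Kruczenski, Nucl. Phys. B 921 (2017). Folklore (Cayley–Hamilton in `SL(2)`).
-/

noncomputable section

open Filter Topology
open scoped Matrix ComplexConjugate
open Literature.MathematicalPhysics.QuantumFieldTheory (LatticeRep Site Edge GaugeConfig)
open Literature.MathematicalPhysics.QuantumLattice (fundamentalLatticeRep fundamentalRep star_coe_eq_adjugate)
open Literature.MathematicalPhysics.QuantumLattice.NarrowWell (trace_im_eq_zero)

namespace Summit.QuantumFields.GaugeBoot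

/-! ## The `SU(2)` trace identity -/

section TraceIdentity

/-- In `SU(2)` the matrix of `h⁻¹` is the adjugate of the matrix of `h`. -/
theorem su2_coe_inv_eq_adjugate (h : Matrix.specialUnitaryGroup (Fin 2) ℂ) :
    ((h⁻¹ : Matrix.specialUnitaryGroup (Fin 2) ℂ) : Matrix (Fin 2) (Fin 2) ℂ) = (h : Matrix (Fin 2) (Fin 2) ℂ).adjugate := by
  rw [← star_coe_eq_adjugate]; rfl

/-- ★ **The `SU(2)` trace identity** `tr g · tr h = tr(gh) + tr(gh⁻¹)` (Cayley–Hamilton: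
`h + adj h = tr h · 1` and `adj h = h⁻¹` in `SU(2)`). [folklore] -/
theorem su2_trace_mul_trace (g h : Matrix.specialUnitaryGroup (Fin 2) ℂ) :
    (g : Matrix (Fin 2) (Fin 2) ℂ).trace * (h : Matrix (Fin 2) (Fin 2) ℂ).trace =
      ((g * h : Matrix.specialUnitaryGroup (Fin 2) ℂ) : Matrix (Fin 2) (Fin 2) ℂ).trace +
        ((g * h⁻¹ : Matrix.specialUnitaryGroup (Fin 2) ℂ) : Matrix (Fin 2) (Fin 2) ℂ).trace := by
  -- Fricke: `tr(AB) + tr(A adj B) = tr A tr B` for `2 × 2` matrices (cf. the tree's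
  -- `trace_mul_add_trace_mul_adjugate` in the Bałaban series, not imported here)
  have fricke : ∀ A B : Matrix (Fin 2) (Fin 2) ℂ, (A * B).trace + (A * B.adjugate).trace = A.trace * B.trace := by
    intro A B
    rw [Matrix.adjugate_fin_two]
    simp [Matrix.trace_fin_two, Matrix.mul_apply, Fin.sum_univ_two]
    ring
  rw [← fricke, ← su2_coe_inv_eq_adjugate]; rfl

end TraceIdentity

/-! ## Wilson loops on the torus -/

section Loops

variable {d L : ℕ} {G : Type*} [Group G] [TopologicalSpace G] [IsTopologicalGroup G] (r : LatticeRep G)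

/-- **Moving the base point along a path** (any gauge group): for a path `γ` from `x` to `y` and a
closed word `w` at `y`, `Re tr hol_x(γ · w · γ̄) = Re tr hol_y(w)` (cyclicity of the trace). -/
theorem loopRe_conj_path (x : Site d L) (γ w : Word d) (hw : Word.endpoint (Word.endpoint x γ) w = Word.endpoint x γ) :
    loopRe r x (γ ++ w ++ γ.reverse) = loopRe r (Word.endpoint x γ) w := by
  ext U
  simp only [loopRe_apply]
  rw [wordHolonomy_append, wordHolonomy_append, Word.endpoint_append, hw, wordHolonomy_reverse, map_mul, map_mul,
    Matrix.trace_mul_cycle, ← map_mul, inv_mul_cancel, map_one, Matrix.one_mul]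

/-- Moving the base point, imaginary parts. -/
theorem loopIm_conj_path (x : Site d L) (γ w : Word d) (hw : Word.endpoint (Word.endpoint x γ) w = Word.endpoint x γ) :
    loopIm r x (γ ++ w ++ γ.reverse) = loopIm r (Word.endpoint x γ) w := by
  ext U
  simp only [loopIm_apply]
  rw [wordHolonomy_append, wordHolonomy_append, Word.endpoint_append, hw, wordHolonomy_reverse, map_mul, map_mul,
    Matrix.trace_mul_cycle, ← map_mul, inv_mul_cancel, map_one, Matrix.one_mul]

omit [TopologicalSpace G] [IsTopologicalGroup G] in
/-- The conjugated word is closed at `x`. -/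
theorem endpoint_conj_path (x : Site d L) (γ w : Word d) (hw : Word.endpoint (Word.endpoint x γ) w = Word.endpoint x γ) :
    Word.endpoint x (γ ++ w ++ γ.reverse) = x := by
  rw [Word.endpoint_append, Word.endpoint_append, hw, Word.endpoint_reverse]

omit [Group G] [TopologicalSpace G] [IsTopologicalGroup G] in
/-- Straight paths: `n` forward steps along axis `i` end at `x + n eᵢ`. -/
theorem endpoint_replicate_fwd (x : Site d L) (i : Fin d) (n : ℕ) :
    Word.endpoint x (List.replicate n (Step.fwd i)) = x + Pi.single i (n : ZMod L) := by
  induction n generalizing x with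
  | zero => simp
  | succ n ih =>
    rw [List.replicate_succ, Word.endpoint_cons, ih]
    simp only [Step.apply, Site.shift, Nat.cast_succ]
    rw [add_assoc, ← Pi.single_add, add_comm (1 : ZMod L)]

omit [Group G] [TopologicalSpace G] [IsTopologicalGroup G] in
/-- ★ **The torus is connected by lattice words**: for all sites `x, y` there is a word from `x` to `y`
(straight runs along the axes). [folklore] -/
theorem exists_word_endpoint [NeZero L] (x y : Site d L) : ∃ γ : Word d, Word.endpoint x γ = y := by
  classical
  -- runs along the axes of a duplicate-free list
  suffices h : ∀ (l : List (Fin d)), l.Nodup → ∀ (v : Site d L), ∃ γ : Word d, ∀ x : Site d L,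
      Word.endpoint x γ = x + ∑ i ∈ l.toFinset, Pi.single i (v i) by
    obtain ⟨γ, hγ⟩ := h (Finset.univ : Finset (Fin d)).toList (Finset.nodup_toList _) (y - x)
    refine ⟨γ, ?_⟩
    rw [hγ x, Finset.toList_toFinset, Finset.univ_sum_single (y - x)]
    abel
  intro l hl v
  induction l with
  | nil => exact ⟨[], fun x => by simp⟩
  | cons i l ih =>
    obtain ⟨γ, hγ⟩ := ih (List.nodup_cons.1 hl).2
    refine ⟨List.replicate (v i).val (Step.fwd i) ++ γ, fun x => ?_⟩
    rw [Word.endpoint_append, endpoint_replicate_fwd, hγ, ZMod.natCast_zmod_val, List.toFinset_cons,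
      Finset.sum_insert (fun h => (List.nodup_cons.1 hl).1 (List.mem_toFinset.1 h)), add_assoc]

variable {r}

/-- The representation field of `fundamentalLatticeRep 2` (definitional). -/
private theorem fundamentalLatticeRep_two_ρ : (fundamentalLatticeRep 2).ρ = fundamentalRep (Fin 2) := rfl

/-- **`SU(2)`: `Im tr hol = 0`.** -/
theorem loopIm_su2 (x : Site d L) (w : Word d) :
    loopIm (fundamentalLatticeRep 2) x w = (0 : C(GaugeConfig d L (Matrix.specialUnitaryGroup (Fin 2) ℂ), ℝ)) := by
  ext U
  rw [loopIm_apply, fundamentalLatticeRep_two_ρ, ContinuousMap.zero_apply]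
  exact trace_im_eq_zero _

/-- ★★ **`SU(2)`: the product of two Wilson loops at `x` is a sum of two Wilson loops at `x`**:
`(Re tr hol u)(Re tr hol v) = Re tr hol(u · v) + Re tr hol(u · v̄)` for closed `u, v`. [folklore] -/
theorem loopRe_mul_loopRe_su2 (x : Site d L) {u v : Word d} (hu : Word.endpoint x u = x) (hv : Word.endpoint x v = x) :
    loopRe (fundamentalLatticeRep 2) x u * loopRe (fundamentalLatticeRep 2) x v =
      loopRe (fundamentalLatticeRep 2) x (u ++ v) + loopRe (fundamentalLatticeRep 2) x (u ++ v.reverse) := by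
  ext U
  simp only [ContinuousMap.mul_apply, ContinuousMap.add_apply, loopRe_apply, fundamentalLatticeRep_two_ρ]
  have hre : ∀ g h : Matrix.specialUnitaryGroup (Fin 2) ℂ,
      ((g : Matrix (Fin 2) (Fin 2) ℂ).trace).re * ((h : Matrix (Fin 2) (Fin 2) ℂ).trace).re =
        ((g : Matrix (Fin 2) (Fin 2) ℂ).trace * (h : Matrix (Fin 2) (Fin 2) ℂ).trace).re := fun g h => by
    rw [Complex.mul_re, trace_im_eq_zero, trace_im_eq_zero, mul_zero, sub_zero]
  have h1 : wordHolonomy U x (u ++ v) = wordHolonomy U x u * wordHolonomy U x v := by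
    rw [wordHolonomy_append, hu]
  have h2 : wordHolonomy U x (u ++ v.reverse) = wordHolonomy U x u * (wordHolonomy U x v)⁻¹ := by
    rw [wordHolonomy_append, hu, ← wordHolonomy_reverse U x v, hv]
  change ((fundamentalRep (Fin 2) _).trace).re * ((fundamentalRep (Fin 2) _).trace).re =
    ((fundamentalRep (Fin 2) _).trace).re + ((fundamentalRep (Fin 2) _).trace).re
  rw [h1, h2]
  change (((wordHolonomy U x u : Matrix.specialUnitaryGroup (Fin 2) ℂ) : Matrix (Fin 2) (Fin 2) ℂ).trace).re *
      (((wordHolonomy U x v : Matrix.specialUnitaryGroup (Fin 2) ℂ) : Matrix (Fin 2) (Fin 2) ℂ).trace).re =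
    (((wordHolonomy U x u * wordHolonomy U x v : Matrix.specialUnitaryGroup (Fin 2) ℂ) : Matrix (Fin 2) (Fin 2) ℂ).trace).re +
      (((wordHolonomy U x u * (wordHolonomy U x v)⁻¹ : Matrix.specialUnitaryGroup (Fin 2) ℂ) :
        Matrix (Fin 2) (Fin 2) ℂ).trace).re
  rw [hre, su2_trace_mul_trace, Complex.add_re]

/-! ## The single-trace span -/

/-- **The single-trace span at `x`**: the linear span of `1` and the Wilson loops `Re tr hol_x(w)`,
`w` closed at `x`. [folklore] -/
def singleTraceSpan (x : Site d L) : Submodule ℝ C(GaugeConfig d L (Matrix.specialUnitaryGroup (Fin 2) ℂ), ℝ) :=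
  Submodule.span ℝ ({1} ∪ {f | ∃ w : Word d, Word.endpoint x w = x ∧ f = loopRe (fundamentalLatticeRep 2) x w})

/-- **All Wilson loop observables** (real and imaginary parts, all base points, closed words). -/
def allLoops (r : LatticeRep G) : Set C(GaugeConfig d L G, ℝ) :=
  {f | ∃ (y : Site d L) (w : Word d), Word.endpoint y w = y ∧ (f = loopRe r y w ∨ f = loopIm r y w)}

/-- Single loops at `x` are in the span. -/
theorem loopRe_mem_singleTraceSpan (x : Site d L) {w : Word d} (hw : Word.endpoint x w = x) :
    loopRe (fundamentalLatticeRep 2) x w ∈ singleTraceSpan (d := d) (L := L) x :=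
  Submodule.subset_span (Or.inr ⟨w, hw, rfl⟩)

/-- `1` is in the span. -/
theorem one_mem_singleTraceSpan (x : Site d L) : (1 : C(_, ℝ)) ∈ singleTraceSpan (d := d) (L := L) x :=
  Submodule.subset_span (Or.inl rfl)

/-- ★★ **The single-trace span is closed under multiplication** (`SU(2)` trace identity). [folklore] -/
theorem mul_mem_singleTraceSpan (x : Site d L) {f g : C(GaugeConfig d L (Matrix.specialUnitaryGroup (Fin 2) ℂ), ℝ)}
    (hf : f ∈ singleTraceSpan (d := d) (L := L) x) (hg : g ∈ singleTraceSpan (d := d) (L := L) x) :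
    f * g ∈ singleTraceSpan (d := d) (L := L) x := by
  -- generators times generators
  have hgen : ∀ a ∈ ({1} ∪ {f | ∃ w : Word d, Word.endpoint x w = x ∧ f = loopRe (fundamentalLatticeRep 2) x w} :
      Set C(GaugeConfig d L (Matrix.specialUnitaryGroup (Fin 2) ℂ), ℝ)),
      ∀ b ∈ ({1} ∪ {f | ∃ w : Word d, Word.endpoint x w = x ∧ f = loopRe (fundamentalLatticeRep 2) x w} :
      Set C(GaugeConfig d L (Matrix.specialUnitaryGroup (Fin 2) ℂ), ℝ)),
      a * b ∈ singleTraceSpan (d := d) (L := L) x := by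
    rintro a (ha | ⟨u, hu, rfl⟩) b (hb | ⟨v, hv, rfl⟩)
    · rw [Set.mem_singleton_iff.1 ha, Set.mem_singleton_iff.1 hb, one_mul]; exact one_mem_singleTraceSpan x
    · rw [Set.mem_singleton_iff.1 ha, one_mul]; exact loopRe_mem_singleTraceSpan x hv
    · rw [Set.mem_singleton_iff.1 hb, mul_one]; exact loopRe_mem_singleTraceSpan x hu
    · rw [loopRe_mul_loopRe_su2 x hu hv]
      refine Submodule.add_mem _ (loopRe_mem_singleTraceSpan x ?_) (loopRe_mem_singleTraceSpan x ?_)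
      · rw [Word.endpoint_append, hu, hv]
      · rw [Word.endpoint_append, hu, ← hv, Word.endpoint_reverse, hv]
  -- bilinearity
  unfold singleTraceSpan at hf hg ⊢
  induction hf using Submodule.span_induction generalizing g with
  | mem a ha =>
    induction hg using Submodule.span_induction with
    | mem b hb => exact hgen a ha b hb
    | zero => rw [mul_zero]; exact Submodule.zero_mem _
    | add b c _ _ ihb ihc => rw [mul_add]; exact Submodule.add_mem _ ihb ihc
    | smul t b _ ih => rw [mul_smul_comm]; exact Submodule.smul_mem _ t ih
  | zero => rw [zero_mul]; exact Submodule.zero_mem _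
  | add a b _ _ iha ihb => rw [add_mul]; exact Submodule.add_mem _ (iha hg) (ihb hg)
  | smul t a _ ih => rw [smul_mul_assoc]; exact Submodule.smul_mem _ t (ih hg)

/-- **The single-trace span as a unital subalgebra.** [folklore] -/
def singleTraceAlgebra (x : Site d L) : Subalgebra ℝ C(GaugeConfig d L (Matrix.specialUnitaryGroup (Fin 2) ℂ), ℝ) where
  carrier := singleTraceSpan (d := d) (L := L) x
  mul_mem' hf hg := mul_mem_singleTraceSpan x hf hg
  add_mem' hf hg := Submodule.add_mem _ hf hg
  algebraMap_mem' c := by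
    rw [Algebra.algebraMap_eq_smul_one]
    exact Submodule.smul_mem _ c (one_mem_singleTraceSpan x)

/-- Membership in `singleTraceAlgebra`. -/
@[simp] theorem mem_singleTraceAlgebra (x : Site d L) {f : C(GaugeConfig d L (Matrix.specialUnitaryGroup (Fin 2) ℂ), ℝ)} :
    f ∈ singleTraceAlgebra (d := d) (L := L) x ↔ f ∈ singleTraceSpan (d := d) (L := L) x := Iff.rfl

/-- **Every Wilson loop observable lies in the single-trace span at `x`** (base-point transport;
imaginary parts vanish). -/
theorem allLoops_subset_singleTraceSpan [NeZero L] (x : Site d L) :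
    allLoops (d := d) (L := L) (fundamentalLatticeRep 2) ⊆ singleTraceSpan (d := d) (L := L) x := by
  rintro f ⟨y, w, hw, hf | hf⟩
  · obtain ⟨γ, hγ⟩ := exists_word_endpoint (d := d) (L := L) x y
    subst hγ
    rw [hf, ← loopRe_conj_path _ x γ w hw]
    exact loopRe_mem_singleTraceSpan x (endpoint_conj_path x γ w hw)
  · rw [hf, loopIm_su2]
    exact Submodule.zero_mem _

/-- ★★★ **`SU(2)`: the multi-trace Wilson loop algebra is the span of the single Wilson loops at one
base point.** The unital `ℝ`-algebra generated by all `Re tr hol_y(w)`, `Im tr hol_y(w)` (all base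
points `y`, all closed words `w`) coincides, as a linear subspace, with
`span {1, Re tr hol_x(w) : w closed at x}`. [folklore] -/
theorem adjoin_loops_eq_singleTraceSpan_su2 [NeZero L] (x : Site d L) :
    Subalgebra.toSubmodule (Algebra.adjoin ℝ (allLoops (d := d) (L := L) (fundamentalLatticeRep 2))) =
      singleTraceSpan (d := d) (L := L) x := by
  apply le_antisymm
  · change Algebra.adjoin ℝ (allLoops (d := d) (L := L) (fundamentalLatticeRep 2)) ≤ singleTraceAlgebra x
    exact Algebra.adjoin_le (allLoops_subset_singleTraceSpan x)
  · refine Submodule.span_le.2 ?_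
    rintro f (hf | ⟨w, hw, rfl⟩)
    · rw [Set.mem_singleton_iff.1 hf]; exact Subalgebra.one_mem _
    · exact Algebra.subset_adjoin ⟨x, w, hw, Or.inl rfl⟩

/-- ★★★ **`SU(2)`: single-trace data determine multi-trace data.** Two linear functionals on the
observables which agree on `1` and on every single Wilson loop `Re tr hol_x(w)` at the base point
`x` agree on the whole multi-trace Wilson loop algebra. [folklore] -/
theorem eqOn_adjoin_loops_of_eqOn_single_su2 [NeZero L] (x : Site d L)
    {φ ψ : C(GaugeConfig d L (Matrix.specialUnitaryGroup (Fin 2) ℂ), ℝ) →ₗ[ℝ] ℝ} (h1 : φ 1 = ψ 1)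
    (hloops : ∀ w : Word d, Word.endpoint x w = x →
      φ (loopRe (fundamentalLatticeRep 2) x w) = ψ (loopRe (fundamentalLatticeRep 2) x w))
    {f : C(GaugeConfig d L (Matrix.specialUnitaryGroup (Fin 2) ℂ), ℝ)}
    (hf : f ∈ Algebra.adjoin ℝ (allLoops (d := d) (L := L) (fundamentalLatticeRep 2))) : φ f = ψ f := by
  have hf' : f ∈ singleTraceSpan (d := d) (L := L) x := by
    rw [← adjoin_loops_eq_singleTraceSpan_su2 x]; exact hf
  clear hf
  unfold singleTraceSpan at hf'
  induction hf' using Submodule.span_induction with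
  | mem g hg =>
    rcases hg with hg | ⟨w, hw, rfl⟩
    · rw [Set.mem_singleton_iff.1 hg]; exact h1
    · exact hloops w hw
  | zero => simp
  | add a b _ _ iha ihb => rw [map_add, map_add, iha, ihb]
  | smul t a _ ih => rw [map_smul, map_smul, ih]

end Loops

end Summit.QuantumFields.GaugeBoot

end
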